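import Summits.BirchSwinnertonDyer.Rank1Residual.GaloisImage.PsiThreeKummerQuarticShapes
import Summits.BirchSwinnertonDyer.Rank1Residual.GaloisImage.PsiThreeRootlessShapesThree
import HarnessLib

/-!
# The Kodaira-`III` shape: `Ψ₃ / 3` is Eisenstein and `ℚ₃(x(P)) ≅ ℚ₃(3^{1/4})` again
# (cell `b2b-bsdres`, team n1011, row T-SSQ3 addendum, seat n1011-p05 GEN 11, FILE F4a — class-free TOOL)

HONEST FRAMING (cell `b2b-bsdres`, run/shared/lean/b2b/bsd-rank1-residual/, verbatim in every
file): the goal of the cell is to DELETE the COMBINATION-SHAPED residual classes of the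
Birch–Swinnerton-Dyer formula for ALL analytic-rank `≤ 1` elliptic curves over `ℚ` — "full BSD
formula for every rank `≤ 1` curve in class `C`" assembled STRICTLY from published theorems — so
that the rank-`≤ 1` remainder becomes exactly the CONSTRUCTION-SHAPED classes, which are TYPED
(missing-input `Prop`s), NOT attempted. This is not "finishing BSD". Team n1011; row T-SSQ3
(`cells/n1011/skel/T-SSQ3.md`), ADDENDUM A1: the THIRD Kodaira symbol of the tame potentially
supersingular locus at `3` (type `III`, `v₃(Δ_min) = 3`), so that T19a's conclusion holds on all of
`SubTprime` (FILE F4b). This file: TOOL theorems over `ℤ₃` only — no definition, no named fact, no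
`sorry`; nothing about any particular curve; nothing booked.

## What

`Ψ₃ = 3x⁴ + b₂x³ + 3b₄x² + 3b₆x + b₈`. On Tate's normal form of type `III` over `ℤ₃` (`a₁, a₂, a₃ ∈ 𝔪`,
`a₄ ∈ 𝔪 ∖ 𝔪²`, `a₆ ∈ 𝔪²`; Silverman *ATAEC* IV.9.4 Step 4): `b₂ = 3(3α₁² + 4α₂)`, `b₄ = 3(…)`,
`b₆ = 3(…)`, `b₈ = 9γ₈` with `γ₈ ≡ −α₄² ≡ −1 (mod 3)` (`IIIForm.*`); a rootless `Ψ₃` forces `9 ∣ b₂`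
(`three_dvd_of_IIIShape_of_forall_not_isRoot`, Hensel in `ℤ₃`); and on the resulting (III) SHAPE
`b₂ = 9γ₂, b₄ = 3γ₄, b₆ = 3γ₆, b₈ = 9γ₈, 3 ∣ γ₈ + 1` the quartic `Ψ₃/3 = x⁴ + 3γ₂x³ + 3γ₄x² + 3γ₆x + 3γ₈`
is monic EISENSTEIN — `Ψ₃` is irreducible over `ℚ₃` — and
`Ψ₃(ϖζ) = 9 · (ζ⁴ + γ₂ϖ³ζ³ + γ₄ϖ²ζ² + γ₆ϖζ + γ₈) = 0` for the Hensel root `ζ ∈ K₄` of F1's quartic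
shape (both in `irreducible_and_exists_kummerRoot_Ψ₃_of_IIIShape`). So type-`III` curves with `E[3]|G_{ℚ₃}` irreducible also
have `ℚ₃(x(P)) ≅ ℚ₃(3^{1/4})` (the projective class of `V₀ ⊗ ω` equals that of `V₀`).

References: J. H. Silverman, *ATAEC* IV.9.4 Step 4 [SilvermanATAEC1994]; *AEC* Ex. 3.7
[SilvermanAEC2009]; cells/n1011/skel/T-SSQ3.md.
-/

noncomputable section

open Polynomial

namespace Summit.BirchSwinnertonDyer.Rank1Residual.GaloisImage.PsiThreeKummer

open Summit.BirchSwinnertonDyer.Rank1Residual.GaloisImage.QuarticKummerThree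

/-! ## §1 Tate's normal form of type `III`: the `b`'s -/

section IIIForm

variable (M : WeierstrassCurve ℤ_[3]) {α₁ α₂ α₃ α₄ α₆ : ℤ_[3]} (ha₁ : M.a₁ = 3 * α₁)
  (ha₂ : M.a₂ = 3 * α₂) (ha₃ : M.a₃ = 3 * α₃) (ha₄ : M.a₄ = 3 * α₄) (ha₆ : M.a₆ = 9 * α₆)
include ha₁ ha₂ ha₃ ha₄ ha₆

omit ha₃ ha₄ ha₆ in
/-- On the `III` form, `b₂ = 3(3α₁² + 4α₂)`. [cite: SilvermanATAEC1994, IV.9.4 Step 4] -/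
theorem IIIForm.b₂_eq : M.b₂ = 3 * (3 * α₁ ^ 2 + 4 * α₂) := by
  rw [WeierstrassCurve.b₂, ha₁, ha₂]; ring

omit ha₂ ha₆ in
/-- On the `III` form, `b₄ = 3(2α₄ + 3α₁α₃)`. [cite: SilvermanATAEC1994, IV.9.4 Step 4] -/
theorem IIIForm.b₄_eq : M.b₄ = 3 * (2 * α₄ + 3 * α₁ * α₃) := by
  rw [WeierstrassCurve.b₄, ha₁, ha₃, ha₄]; ring

omit ha₁ ha₂ ha₄ in
/-- On the `III` form, `b₆ = 3(3α₃² + 12α₆)`. [cite: SilvermanATAEC1994, IV.9.4 Step 4] -/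
theorem IIIForm.b₆_eq : M.b₆ = 3 * (3 * α₃ ^ 2 + 12 * α₆) := by
  rw [WeierstrassCurve.b₆, ha₃, ha₆]; ring

/-- On the `III` form, `b₈ = 9(9α₁²α₆ + 12α₂α₆ − 3α₁α₃α₄ + 3α₂α₃² − α₄²)`.
[cite: SilvermanATAEC1994, IV.9.4 Step 4] -/
theorem IIIForm.b₈_eq : M.b₈ =
    9 * (9 * α₁ ^ 2 * α₆ + 12 * α₂ * α₆ - 3 * α₁ * α₃ * α₄ + 3 * α₂ * α₃ ^ 2 - α₄ ^ 2) := by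
  rw [WeierstrassCurve.b₈, ha₁, ha₂, ha₃, ha₄, ha₆]; ring

omit ha₁ ha₂ ha₃ ha₄ ha₆ in
/-- **On the `III` form with `a₄ = 3α₄`, `α₄ ∈ ℤ₃ˣ` (`9 ∤ a₄`): `γ₈ = b₈/9` satisfies `3 ∣ γ₈ + 1`.**
[folklore] -/
theorem IIIForm.three_dvd_γ₈_add_one (hα₄ : IsUnit α₄) :
    (3 : ℤ_[3]) ∣
      (9 * α₁ ^ 2 * α₆ + 12 * α₂ * α₆ - 3 * α₁ * α₃ * α₄ + 3 * α₂ * α₃ ^ 2 - α₄ ^ 2) + 1 := by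
  rw [three_dvd_iff_toZMod_eq_zero]
  have h4 : PadicInt.toZMod α₄ ≠ 0 := (hα₄.map (PadicInt.toZMod (p := 3))).ne_zero
  simp only [map_add, map_sub, map_mul, map_pow, map_ofNat, map_one]
  have h3 : (3 : ZMod 3) = 0 := by decide
  have h12 : (12 : ZMod 3) = 0 := by decide
  have h9 : (9 : ZMod 3) = 0 := by decide
  have key : 9 * PadicInt.toZMod α₁ ^ 2 * PadicInt.toZMod α₆ + 12 * PadicInt.toZMod α₂ * PadicInt.toZMod α₆ -
      3 * PadicInt.toZMod α₁ * PadicInt.toZMod α₃ * PadicInt.toZMod α₄ +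
      3 * PadicInt.toZMod α₂ * PadicInt.toZMod α₃ ^ 2 - PadicInt.toZMod α₄ ^ 2 + 1 =
      -PadicInt.toZMod α₄ ^ 2 + 1 := by
    rw [h3, h12, h9]; ring
  have aux : ∀ y : ZMod 3, y ≠ 0 → -y ^ 2 + 1 = 0 := by decide
  rw [key]
  exact aux _ h4

end IIIForm

/-! ## §2 Rootless `Ψ₃` forces `9 ∣ b₂` on the `III` form -/

section Rootless

variable (M : WeierstrassCurve ℤ_[3])

/-- `Ψ₃` of the base change to `ℚ₃` at `z ∈ ℤ₃`, on the coefficients `b₂ = 3γ, b₄ = 3γ₄, b₆ = 3γ₆,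
b₈ = 9γ₈`: `Ψ₃(z) = 3 (z⁴ + γz³ + 3γ₄z² + 3γ₆z + 3γ₈)`. [folklore] -/
theorem eval_Ψ₃_IIIShape {γ γ₄ γ₆ γ₈ : ℤ_[3]} (hb₂ : M.b₂ = 3 * γ) (hb₄ : M.b₄ = 3 * γ₄)
    (hb₆ : M.b₆ = 3 * γ₆) (hb₈ : M.b₈ = 9 * γ₈) (z : ℤ_[3]) :
    (M.map (algebraMap ℤ_[3] ℚ_[3])).Ψ₃.eval (algebraMap ℤ_[3] ℚ_[3] z) =
      3 * algebraMap ℤ_[3] ℚ_[3] (z ^ 4 + γ * z ^ 3 + 3 * γ₄ * z ^ 2 + 3 * γ₆ * z + 3 * γ₈) := by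
  simp only [WeierstrassCurve.Ψ₃, WeierstrassCurve.map_b₂, WeierstrassCurve.map_b₄,
    WeierstrassCurve.map_b₆, WeierstrassCurve.map_b₈, eval_add, eval_mul, eval_pow, eval_C, eval_X,
    eval_ofNat, hb₂, hb₄, hb₆, hb₈, map_add, map_mul, map_pow, map_ofNat]
  ring

/-- **On the `III` form, rootless `Ψ₃` forces `9 ∣ b₂`**: with `b₂ = 3γ`, `b₄ = 3γ₄`, `b₆ = 3γ₆`,
`b₈ = 9γ₈`, if `γ` were a unit then `z⁴ + γz³ + 3γ₄z² + 3γ₆z + 3γ₈` would have a Hensel root `z ∈ ℤ₃`,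
a root of `Ψ₃` in `ℚ₃`. [folklore] -/
theorem three_dvd_of_IIIShape_of_forall_not_isRoot {γ γ₄ γ₆ γ₈ : ℤ_[3]} (hb₂ : M.b₂ = 3 * γ)
    (hb₄ : M.b₄ = 3 * γ₄) (hb₆ : M.b₆ = 3 * γ₆) (hb₈ : M.b₈ = 9 * γ₈)
    (h : ∀ r : ℚ_[3], ¬ ((M.map (algebraMap ℤ_[3] ℚ_[3])).Ψ₃).IsRoot r) : (3 : ℤ_[3]) ∣ γ := by
  by_contra hnd
  have hu : IsUnit γ := (isUnit_iff_not_three_dvd _).mpr hnd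
  obtain ⟨z, hz⟩ := exists_root_of_unitCubeShape hu γ₈ γ₆ γ₄
  refine h (algebraMap ℤ_[3] ℚ_[3] z) ?_
  have h3 := eval_Ψ₃_IIIShape M hb₂ hb₄ hb₆ hb₈ z
  rw [hz, map_zero, mul_zero] at h3
  exact h3

end Rootless

/-! ## §3 (III) The Kodaira-`III` shape: `b₂ = 9γ₂, b₄ = 3γ₄, b₆ = 3γ₆, b₈ = 9γ₈, γ₈ ≡ −1 (mod 3)` -/

section IIIShape

variable (M : WeierstrassCurve ℤ_[3]) {γ₂ γ₄ γ₆ γ₈ : ℤ_[3]} (hb₂ : M.b₂ = 9 * γ₂)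
  (hb₄ : M.b₄ = 3 * γ₄) (hb₆ : M.b₆ = 3 * γ₆) (hb₈ : M.b₈ = 9 * γ₈) (hγ₈ : (3 : ℤ_[3]) ∣ γ₈ + 1)
include hb₂ hb₄ hb₆ hb₈ hγ₈

/-- **(III) THE KODAIRA-`III` SHAPE: `Ψ₃` is irreducible over `ℚ₃` AND has the root `x = ϖζ ∈ K₄`.**
Irreducibility: `Ψ₃ = 3 · P` with `P = x⁴ + 3γ₂x³ + 3γ₄x² + 3γ₆x + 3γ₈` monic and Eisenstein at `3`
(`γ₈` a unit), Gauss's lemma. Root: `ζ` the Hensel root of `z⁴ + γ₂ϖ³z³ + γ₄ϖ²z² + γ₆ϖz + γ₈`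
(F1 `exists_root_quarticShape`), `Ψ₃(ϖζ) = 9 · 0`. (One statement for both halves: the two halves
separately have the binder shape of F2b's `III*` lemmas.) [folklore] -/
theorem irreducible_and_exists_kummerRoot_Ψ₃_of_IIIShape :
    Irreducible (M.map (algebraMap ℤ_[3] ℚ_[3])).Ψ₃ ∧
      ∃ x : AdjoinRoot (X ^ 4 - C (3 : ℚ_[3])), aeval x (M.map (algebraMap ℤ_[3] ℚ_[3])).Ψ₃ = 0 := by
  refine ⟨?_, ?_⟩
  · have hu := isUnit_β₈_of_IIIstarShape hγ₈
    set P : ℤ_[3][X] := Polynomial.C 1 * X ^ 4 + Polynomial.C (3 * γ₂) * X ^ 3 +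
      Polynomial.C (3 * γ₄) * X ^ 2 + Polynomial.C (3 * γ₆) * X + Polynomial.C (3 * γ₈) with hP
    have h3γ₈ : 3 * γ₈ ∉ IsLocalRing.maximalIdeal ℤ_[3] ^ 2 := by
      rw [PadicInt.maximalIdeal_eq_span_p, Ideal.span_singleton_pow, Ideal.mem_span_singleton]
      rintro ⟨c, hc⟩
      have h9 : γ₈ = 3 * c := by
        have h3 : (3 : ℤ_[3]) ≠ 0 := by norm_num
        apply mul_left_cancel₀ h3
        rw [hc]; push_cast; ring
      exact (IsLocalRing.mem_maximalIdeal _).mp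
        (by rw [h9]; exact Ideal.mul_mem_right _ _ three_mem_maximalIdeal) hu
    have hEis : P.IsEisensteinAt (IsLocalRing.maximalIdeal ℤ_[3]) :=
      isEisensteinAt_quartic one_ne_zero
        (fun h ↦ (IsLocalRing.mem_maximalIdeal _).mp h isUnit_one)
        (Ideal.mul_mem_right _ _ three_mem_maximalIdeal)
        (Ideal.mul_mem_right _ _ three_mem_maximalIdeal)
        (Ideal.mul_mem_right _ _ three_mem_maximalIdeal)
        (Ideal.mul_mem_right _ _ three_mem_maximalIdeal) h3γ₈
    have hmonic : P.Monic := by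
      rw [Monic, leadingCoeff_quartic one_ne_zero]
    have hirr : Irreducible P :=
      hEis.irreducible (IsLocalRing.maximalIdeal.isMaximal ℤ_[3]).isPrime hmonic.isPrimitive
        (by rw [natDegree_quartic one_ne_zero]; norm_num)
    have hirrK : Irreducible (P.map (algebraMap ℤ_[3] ℚ_[3])) :=
      (hmonic.irreducible_iff_irreducible_map_fraction_map (K := ℚ_[3])).mp hirr
    -- `Ψ₃ = 3 · P` over `ℚ₃`
    have hfac : (M.map (algebraMap ℤ_[3] ℚ_[3])).Ψ₃ =
        Polynomial.C (3 : ℚ_[3]) * P.map (algebraMap ℤ_[3] ℚ_[3]) := by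
      rw [Ψ₃_eq_quartic, hP]
      simp only [WeierstrassCurve.map_b₂, WeierstrassCurve.map_b₄, WeierstrassCurve.map_b₆,
        WeierstrassCurve.map_b₈, hb₂, hb₄, hb₆, hb₈, map_mul, map_ofNat, map_one, Polynomial.map_add,
        Polynomial.map_mul, Polynomial.map_pow, Polynomial.map_C, Polynomial.map_X,
        Polynomial.map_ofNat, Polynomial.map_one]
      ring
    have hunit : IsUnit (Polynomial.C (3 : ℚ_[3])) := isUnit_C.mpr (by norm_num)
    rw [hfac, irreducible_isUnit_mul hunit]
    exact hirrK
  · set ι : ℤ_[3] →+* AdjoinRoot (X ^ 4 - C (3 : ℚ_[3])) := algebraMap ℤ_[3] _ with hι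
    set ϖ : AdjoinRoot (X ^ 4 - C (3 : ℚ_[3])) := AdjoinRoot.root (X ^ 4 - C (3 : ℚ_[3])) with hϖ
    have hϖ4 : ϖ ^ 4 = 3 := root_pow_four
    obtain ⟨ζ, hζ⟩ := exists_root_quarticShape γ₈ γ₆ γ₄ γ₂ hγ₈
    simp only [← algebraMap_padicInt_kummerField, ← hι] at hζ
    refine ⟨ϖ * ζ, ?_⟩
    rw [aeval_Ψ₃_map, ← hι, hb₂, hb₄, hb₆, hb₈]
    simp only [map_mul, map_ofNat]
    linear_combination (9 : AdjoinRoot (X ^ 4 - C (3 : ℚ_[3]))) * hζ + (3 * ζ ^ 4) * hϖ4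

end IIIShape

end Summit.BirchSwinnertonDyer.Rank1Residual.GaloisImage.PsiThreeKummer

end
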